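import Mathlib
import HarnessLib
import Summits.HubbardSuperconductivity.HubbardSuperconductivity.Theorems.KLProgrammeKLRegimeVolumeLimitTwoPointHamiltonianLimit
import Summits.HubbardSuperconductivity.HubbardSuperconductivity.Theorems.KLProgrammeKLRegimeVolumeLimitBoundGlueTwoPoint
import Summits.HubbardSuperconductivity.HubbardSuperconductivity.Theorems.KLProgrammeKLRegimeVolumeLimitBoundDoor

/-!
# The label-uniform cutoff limit (`hcut` of the Cauchy doors) may be taken towards the HAMILTONIAN proxy: uniqueness of per-label limits
# (seat hubbard-kl-k3c5-p2, g3, «analytic-continuation-free assembly via FinalTwoLegVolLimit»)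

Route `KLProgramme`, child VOLUME-LIMIT (stmt-HubbardSuperconductivity-19858 / its gen-5 re-base), stub `stub_vl_twoVolumeRate`.  k3c4-p1's doors
(`twoVolumeRate_of_matsubaraLimit`, `stub_vl_twoVolumeRate_of_bareSplit[_V14]`) split the Cauchy stub into `hcut` — at each volume a LABEL-UNIFORM
`M → ∞` limit of the bare carrier towards SOME proxy `Sinf L n k σ` — and `hvol` — a two-volume rate OF THAT PROXY.  `hcut` is being supplied with a
Grassmann-side proxy (k3c5-p3's T1: occupation + six-point limit objects).  This module shows that the proxy in `hcut` can be REPLACED by any other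
family of per-label limits — in particular, under (H1), by the Hamiltonian re-amputated self-energy of `…TwoPointHamiltonianLimit` — so that `hvol`
becomes a statement about the finite-volume Gibbs state of `hubbardTorusWith` alone:

* `labelLimit_unique` — two per-label limit values (ε–M₁ form along the kept labels of a fixed Matsubara integer) of the same carrier coincide;
* **`hcut_transfer`** — `hcut` at `L` with proxy `S` + per-label limits towards `S'` at `L` ⟹ `hcut` at `L` with proxy `S'` (same thresholds);
* **`hcut_hamiltonian_of_H1`** — under (H1) at `L ≥ 3`: `hcut` at `L` with ANY proxy ⟹ `hcut` at `L` with the proxy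
  `(n, k, σ) ↦ (1/D_k − 𝒢_{H'}(k₀(n), −k))·D_k²` (`D_k = −ik₀ + ε(k) − μ`, `H' = hubbardTorusWith 2 L 1 U (μ + U/2)`; spin by
  `klSelfEnergy_nScales_succ_spin_eq`).

Everything is proved; no definition; every coupling.
-/

noncomputable section

namespace Summit.HubbardSuperconductivity.HubbardSuperconductivity.Theorems.TwoPointAssembly

set_option linter.dupNamespace false -- summit = problem name (single-conjunct summit), D-0017

open Finset Filter Topology MeasureTheory intervalIntegral Complex Literature.MathematicalPhysics.QuantumLattice Literature.Probability.LatticeModels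
  GrassmannAlgebra
open Summit.HubbardSuperconductivity.HubbardSuperconductivity.Theorems.ThermalGreen
open Summit.HubbardSuperconductivity.HubbardSuperconductivity.Theorems.MatsubaraAllU
open Summit.HubbardSuperconductivity.HubbardSuperconductivity.Theorems.KLRegimeSplit
open Summit.HubbardSuperconductivity.HubbardSuperconductivity.Theorems.KLProgrammeLegKernels
open scoped ComplexConjugate

variable {L : ℕ} [NeZero L]

omit [NeZero L] in
/-- **Uniqueness of per-label limits.**  If along the kept labels `ω` of a fixed Matsubara integer `n` a family `F M ω` is eventually `ε`-close to
`a` and to `b` for every `ε > 0`, then `a = b` (for `M > |n|` such a label exists). -/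
theorem labelLimit_unique {F : (M : ℕ) → MatsubaraIdx M → ℂ} {n : ℤ} {a b : ℂ}
    (ha : ∀ ε : ℝ, 0 < ε → ∃ M₁ : ℕ, ∀ M : ℕ, M₁ ≤ M → ∀ ω : MatsubaraIdx M, matsubaraInt M ω = n → ‖F M ω - a‖ ≤ ε)
    (hb : ∀ ε : ℝ, 0 < ε → ∃ M₁ : ℕ, ∀ M : ℕ, M₁ ≤ M → ∀ ω : MatsubaraIdx M, matsubaraInt M ω = n → ‖F M ω - b‖ ≤ ε) :
    a = b := by
  by_contra hne
  have hd : 0 < ‖a - b‖ := norm_pos_iff.mpr (sub_ne_zero.mpr hne)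
  obtain ⟨M₁, hM₁⟩ := ha (‖a - b‖ / 3) (by positivity)
  obtain ⟨M₂, hM₂⟩ := hb (‖a - b‖ / 3) (by positivity)
  set M : ℕ := max (max M₁ M₂) (n.natAbs + 1) with hM
  have hMn : n.natAbs < M := lt_of_lt_of_le (Nat.lt_succ_self _) (le_max_right _ _)
  obtain ⟨ω, hω⟩ := exists_matsubaraIdx_of_natAbs_lt hMn
  have h1 := hM₁ M (le_trans (le_max_left _ _) (le_max_left _ _)) ω hω
  have h2 := hM₂ M (le_trans (le_max_right _ _) (le_max_left _ _)) ω hω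
  have : ‖a - b‖ ≤ 2 * (‖a - b‖ / 3) :=
    calc ‖a - b‖ = ‖(F M ω - b) - (F M ω - a)‖ := by ring_nf
      _ ≤ ‖F M ω - b‖ + ‖F M ω - a‖ := norm_sub_le _ _
      _ ≤ ‖a - b‖ / 3 + ‖a - b‖ / 3 := add_le_add h2 h1
      _ = 2 * (‖a - b‖ / 3) := by ring
  linarith

/-- **PROXY TRANSFER FOR `hcut` at one volume.**  A label-uniform cutoff limit towards a proxy `S` and per-label limits towards `S'` (same carrier)
give the label-uniform cutoff limit towards `S'`, with the same thresholds (the proxies agree label by label). -/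
theorem hcut_transfer {β U μ : ℝ} (S S' : ℤ → TorusSite 2 L → Fin 2 → ℂ)
    (hcut : ∀ ε : ℝ, 0 < ε → ∃ M₁ : ℕ, ∀ (M : ℕ) [NeZero M], M₁ ≤ M → ∀ (ω : MatsubaraIdx M) (k : TorusSite 2 L) (σ : Fin 2),
      ‖klSelfEnergy L M β U μ 0 klE0 (nScales β + 1) (ω, k) σ - S (matsubaraInt M ω) k σ‖ ≤ ε)
    (hper : ∀ (n : ℤ) (k : TorusSite 2 L) (σ : Fin 2), ∀ ε : ℝ, 0 < ε → ∃ M₁ : ℕ, ∀ M : ℕ, M₁ ≤ M →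
      ∀ ω : MatsubaraIdx M, matsubaraInt M ω = n → ‖klSelfEnergy L M β U μ 0 klE0 (nScales β + 1) (ω, k) σ - S' n k σ‖ ≤ ε) :
    ∀ ε : ℝ, 0 < ε → ∃ M₁ : ℕ, ∀ (M : ℕ) [NeZero M], M₁ ≤ M → ∀ (ω : MatsubaraIdx M) (k : TorusSite 2 L) (σ : Fin 2),
      ‖klSelfEnergy L M β U μ 0 klE0 (nScales β + 1) (ω, k) σ - S' (matsubaraInt M ω) k σ‖ ≤ ε := by
  have heq : ∀ n k σ, S n k σ = S' n k σ := by
    intro n k σ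
    refine labelLimit_unique (F := fun M ω => klSelfEnergy L M β U μ 0 klE0 (nScales β + 1) (ω, k) σ) (n := n) ?_ (hper n k σ)
    intro ε hε
    obtain ⟨M₁, hM₁⟩ := hcut ε hε
    refine ⟨M₁ + 1, fun M hM ω hω => ?_⟩
    haveI : NeZero M := ⟨by omega⟩
    have h := hM₁ M (by omega) ω k σ
    rwa [hω] at h
  intro ε hε
  obtain ⟨M₁, hM₁⟩ := hcut ε hε
  refine ⟨M₁, fun M _ hM ω k σ => ?_⟩
  rw [← heq]
  exact hM₁ M hM ω k σ

/-- **`hcut` TOWARDS THE HAMILTONIAN PROXY** (under (H1) at `L ≥ 3`, every coupling): if at volume `L` the bare carrier has a label-uniform cutoff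
limit towards SOME proxy, then it has it towards the re-amputated Hamiltonian self-energy
`(n, k, σ) ↦ (1/D_k − 𝒢_{H'}(k₀(n), −k))·D_k²` (`D_k = −ik₀(n) + ε(k) − μ`, `k₀(n) = (2n+1)π/β`), with the same threshold. -/
theorem hcut_hamiltonian_of_H1 (hL : 3 ≤ L) {β : ℝ} (hβ : 0 < β) (U μ : ℝ)
    (hH1 : ∀ (x y : TorusSite 2 L), ∀ s ∈ Set.Ioo (0 : ℝ) β,
      Tendsto (fun M : ℕ => gaussExpect ℂ (hubbardCovariance L M β μ 0)
          (positionField L M β 0 0 x s * positionField L M β 1 0 y 0 * grassmannExp (-(hubbardInteraction L M β U)))) atTop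
        (𝓝 ((Real.exp (-(β * U / 4 * (L : ℝ) ^ 2)) : ℂ) *
          (Matrix.gibbsWeight (β - s) (hubbardTorusWith 2 L 1 U (μ + U / 2)) * creation (orb (FermionTorus.ofTorusSite x) 0) *
            (Matrix.gibbsWeight s (hubbardTorusWith 2 L 1 U (μ + U / 2)) * annihilation (orb (FermionTorus.ofTorusSite y) 0))).trace /
          Matrix.partitionFn β (hubbardTorusWith 2 L 1 0 μ))))
    (S : ℤ → TorusSite 2 L → Fin 2 → ℂ)
    (hcut : ∀ ε : ℝ, 0 < ε → ∃ M₁ : ℕ, ∀ (M : ℕ) [NeZero M], M₁ ≤ M → ∀ (ω : MatsubaraIdx M) (k : TorusSite 2 L) (σ : Fin 2),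
      ‖klSelfEnergy L M β U μ 0 klE0 (nScales β + 1) (ω, k) σ - S (matsubaraInt M ω) k σ‖ ≤ ε) :
    ∀ ε : ℝ, 0 < ε → ∃ M₁ : ℕ, ∀ (M : ℕ) [NeZero M], M₁ ≤ M → ∀ (ω : MatsubaraIdx M) (k : TorusSite 2 L) (σ : Fin 2),
      ‖klSelfEnergy L M β U μ 0 klE0 (nScales β + 1) (ω, k) σ -
          (1 / (-Complex.I * ((Real.pi * (2 * ((matsubaraInt M ω : ℤ) : ℝ) + 1) / β : ℝ) : ℂ) + (nambuXiCT L μ 0 k : ℂ)) -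
              ∫ τ in (0 : ℝ)..β, cexp (I * ((Real.pi * (2 * ((matsubaraInt M ω : ℤ) : ℝ) + 1) / β : ℝ) : ℂ) * τ) *
                Matrix.gibbsState β (hubbardTorusWith 2 L 1 U (μ + U / 2))
                  (Matrix.imagTimeEvolve (hubbardTorusWith 2 L 1 U (μ + U / 2)) (τ : ℂ) (momentumAnnihilation (-k) 0) *
                    momentumCreation (-k) 0)) *
            (-Complex.I * ((Real.pi * (2 * ((matsubaraInt M ω : ℤ) : ℝ) + 1) / β : ℝ) : ℂ) + (nambuXiCT L μ 0 k : ℂ)) ^ 2‖ ≤ ε := by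
  refine hcut_transfer S (fun n k _ =>
      (1 / (-Complex.I * ((Real.pi * (2 * (n : ℝ) + 1) / β : ℝ) : ℂ) + (nambuXiCT L μ 0 k : ℂ)) -
          ∫ τ in (0 : ℝ)..β, cexp (I * ((Real.pi * (2 * (n : ℝ) + 1) / β : ℝ) : ℂ) * τ) *
            Matrix.gibbsState β (hubbardTorusWith 2 L 1 U (μ + U / 2))
              (Matrix.imagTimeEvolve (hubbardTorusWith 2 L 1 U (μ + U / 2)) (τ : ℂ) (momentumAnnihilation (-k) 0) *
                momentumCreation (-k) 0)) *
        (-Complex.I * ((Real.pi * (2 * (n : ℝ) + 1) / β : ℝ) : ℂ) + (nambuXiCT L μ 0 k : ℂ)) ^ 2) hcut ?_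
  intro n k σ ε hε
  obtain ⟨M₁, hM₁⟩ := klSelfEnergy_bare_label_limit_eq_reamputated hL hβ U μ hH1 n k ε hε
  refine ⟨M₁, fun M hM ω hω => ?_⟩
  rw [klSelfEnergy_nScales_succ_spin_eq]
  exact hM₁ M hM ω hω

end Summit.HubbardSuperconductivity.HubbardSuperconductivity.Theorems.TwoPointAssembly

end
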